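import Summits.QuantumFields.YangMills.Theses.ParabolicTrajectory
import Literature.MathematicalPhysics.QuantumFieldTheory.LatticeGaugeProofs
import Literature.MathematicalPhysics.QuantumFieldTheory.TorusFreeTransfer

/-!
# `BalabanStepParabolic` — negative-side support V: torus Wilson action facts (unitarity, locality, continuity)

Support file for crux `stmt-QuantumFields-9684` (`ParabolicTrajectory.BalabanStepParabolic`), extracted from the
standing disprover's work file `Cruxes/BalabanStepParabolic/Disproof.lean` §E (cycle 2), part 1 of 3 of the proof of
FINITE-TORUS REGULARITY (the RG-free input that makes every EVEN block factor junk-inhabited). Tree objects only.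

* `pDef`/`pDef_nonneg`/`pDef_le_wilsonAction`/`wilsonAction_nonneg'`: by unitarity (`abs_re_trace_le_of_mem_unitaryGroup`
  of `Sweep1AreaLawProofs`) the Wilson action is a sum of non-negative plaquette deficits; `wilsonAction_one`.
  (Continuity of the action is `continuous_wilsonAction` of `TorusFreeTransfer`.)
* `plaquetteHolonomyZd_shift_lift`: the origin plaquette of the shifted periodic lift is the torus plaquette at
  `x mod T`; `Pmax`, `Pmax_sub_actionDensity(_nonneg/_le)`: the local deficit of the action density (the curvature
  species `r.curvature.F = actionDensity r.ρ`) satisfies `0 ≤ Pmax − P(τₓŨ) ≤ 16 S_W(U)`; `actionDensity_lift_le_Pmax`.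
-/

namespace Summit.QuantumFields.YangMills.Theorems.BalabanStepParabolic.Negative

open scoped SchwartzMap
open MeasureTheory Filter Topology
open Literature.MathematicalPhysics.QuantumFieldTheory Literature.MathematicalPhysics.AQFT
open Literature.MathematicalPhysics.QuantumLattice
open Literature.Probability.LatticeModels (box Torus.proj Torus.proj_apply)

noncomputable section

/-- `proj (x + eᵢ) = proj x + eᵢ` on the discrete torus. [folklore] -/
theorem proj_add_single (T : ℕ) (x : Fin 4 → ℤ) (i : Fin 4) :
    Torus.proj T (x + Pi.single i 1) = Torus.proj T x + Pi.single i 1 := by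
  funext k
  by_cases h : k = i
  · subst h; simp [Torus.proj_apply]
  · simp [Torus.proj_apply, h]

section ShiftLift

variable {G : Type} [Group G] [MeasurableSpace G]

/-- The plaquette at the origin of the shifted periodic lift is the torus plaquette at `x mod T`. [folklore] -/
theorem plaquetteHolonomyZd_shift_lift (T : ℕ) (U : GaugeConfig 4 T G) (x : Fin 4 → ℤ)
    (i j : Fin 4) :
    plaquetteHolonomyZd (configShift (-x) (torusLift T U)) 0 i j =
      plaquetteHolonomy U (Torus.proj T x) i j := by
  simp only [plaquetteHolonomyZd, configShift_apply, torusLift, Function.comp_apply, torusEdge,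
    plaquetteHolonomy, Literature.MathematicalPhysics.QuantumFieldTheory.Site.shift, sub_neg_eq_add]
  rw [zero_add, zero_add, zero_add, add_comm (Pi.single i 1) x, add_comm (Pi.single j 1) x,
    proj_add_single, proj_add_single]

omit [Group G] in
/-- Shifting by `0` does nothing. [folklore] -/
theorem configShift_zero' (V : LGConfig 4 G) : configShift 0 V = V := by
  ext e; simp

end ShiftLift

section TorusRegularity

variable {G : Type} [Group G] [TopologicalSpace G] [IsTopologicalGroup G] [CompactSpace G]
  [MeasurableSpace G] [BorelSpace G] (r : LatticeRep G)

omit [IsTopologicalGroup G] [MeasurableSpace G] [BorelSpace G] in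
include r in
/-- A faithful continuous matrix representation makes the compact group second countable. [folklore] -/
theorem secondCountable_of_latticeRep : SecondCountableTopology G :=
  (Continuous.isClosedEmbedding r.continuous r.injective).isEmbedding.secondCountableTopology

/-- The deficit `N − Re tr ρ(U_p)` of the torus plaquette at `x` in the `(i, j)` plane. -/
def pDef {T : ℕ} (U : GaugeConfig 4 T G) (x : Fin 4 → ZMod T) (i j : Fin 4) : ℝ :=
  (r.N : ℝ) - (r.ρ (plaquetteHolonomy U x i j)).trace.re

omit [IsTopologicalGroup G] [CompactSpace G] [MeasurableSpace G] [BorelSpace G] in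
/-- Plaquette deficits are non-negative (unitarity). [folklore] -/
theorem pDef_nonneg {T : ℕ} (U : GaugeConfig 4 T G) (x : Fin 4 → ZMod T) (i j : Fin 4) :
    0 ≤ pDef r U x i j :=
  sub_nonneg.2 ((le_abs_self _).trans (abs_re_trace_le_of_mem_unitaryGroup (r.mem_unitary _)))

omit [IsTopologicalGroup G] [CompactSpace G] [MeasurableSpace G] [BorelSpace G] in
/-- The Wilson action is the sum of the plaquette deficits. [folklore] -/
theorem wilsonAction_eq_sum_pDef {T : ℕ} [NeZero T] (U : GaugeConfig 4 T G) :
    wilsonAction r.ρ U = ∑ p : Plaquette 4 T, pDef r U p.1 p.2.1.1 p.2.1.2 := by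
  unfold wilsonAction pDef; rfl

omit [IsTopologicalGroup G] [CompactSpace G] [MeasurableSpace G] [BorelSpace G] in
/-- The Wilson action is non-negative (unitarity). [folklore] -/
theorem wilsonAction_nonneg' {T : ℕ} [NeZero T] (U : GaugeConfig 4 T G) : 0 ≤ wilsonAction r.ρ U := by
  rw [wilsonAction_eq_sum_pDef]
  exact Finset.sum_nonneg fun p _ => pDef_nonneg r U _ _ _

omit [IsTopologicalGroup G] [CompactSpace G] [MeasurableSpace G] [BorelSpace G] in
/-- One plaquette deficit is at most the whole Wilson action. [folklore] -/
theorem pDef_le_wilsonAction {T : ℕ} [NeZero T] (U : GaugeConfig 4 T G)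
    (x : Fin 4 → ZMod T) {i j : Fin 4} (hij : i < j) :
    pDef r U x i j ≤ wilsonAction r.ρ U := by
  rw [wilsonAction_eq_sum_pDef]
  have h := Finset.single_le_sum (s := (Finset.univ : Finset (Plaquette 4 T)))
    (f := fun p : Plaquette 4 T => pDef r U p.1 p.2.1.1 p.2.1.2)
    (fun p _ => pDef_nonneg r U _ _ _) (Finset.mem_univ ((x, ⟨(i, j), hij⟩) : Plaquette 4 T))
  exact h

omit [IsTopologicalGroup G] [CompactSpace G] [MeasurableSpace G] [BorelSpace G] in
/-- The trivial configuration has zero Wilson action. [folklore] -/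
theorem wilsonAction_one {T : ℕ} [NeZero T] : wilsonAction r.ρ (1 : GaugeConfig 4 T G) = 0 := by
  simp [wilsonAction, plaquetteHolonomy, Matrix.trace_one]

/-- `∑_{i<j} N`, the value of the action density on flat configurations. -/
def Pmax : ℝ := ∑ i : Fin 4, ∑ j : Fin 4, if i < j then (r.N : ℝ) else 0

omit [IsTopologicalGroup G] [CompactSpace G] [BorelSpace G] in
/-- The local action deficit in terms of plaquette deficits. [folklore] -/
theorem Pmax_sub_actionDensity (T : ℕ) (U : GaugeConfig 4 T G) (x : Fin 4 → ℤ) :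
    Pmax r - actionDensity r.ρ (configShift (-x) (torusLift T U)) =
      ∑ i : Fin 4, ∑ j : Fin 4, if i < j then pDef r U (Torus.proj T x) i j else 0 := by
  unfold Pmax actionDensity
  rw [← Finset.sum_sub_distrib]
  refine Finset.sum_congr rfl fun i _ => ?_
  rw [← Finset.sum_sub_distrib]
  refine Finset.sum_congr rfl fun j _ => ?_
  split_ifs with hij
  · simp [plaquetteObs, plaquetteHolonomyZd_shift_lift, pDef]
  · simp

omit [IsTopologicalGroup G] [CompactSpace G] [BorelSpace G] in
/-- The local action deficit is non-negative. [folklore] -/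
theorem Pmax_sub_actionDensity_nonneg (T : ℕ) (U : GaugeConfig 4 T G) (x : Fin 4 → ℤ) :
    0 ≤ Pmax r - actionDensity r.ρ (configShift (-x) (torusLift T U)) := by
  rw [Pmax_sub_actionDensity]
  refine Finset.sum_nonneg fun i _ => Finset.sum_nonneg fun j _ => ?_
  split_ifs
  · exact pDef_nonneg r U _ _ _
  · exact le_rfl

omit [IsTopologicalGroup G] [CompactSpace G] [BorelSpace G] in
/-- The local action deficit is controlled by the total action: `Pmax − P(τₓŨ) ≤ 16 S_W(U)`. [folklore] -/
theorem Pmax_sub_actionDensity_le {T : ℕ} [NeZero T] (U : GaugeConfig 4 T G) (x : Fin 4 → ℤ) :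
    Pmax r - actionDensity r.ρ (configShift (-x) (torusLift T U)) ≤ 16 * wilsonAction r.ρ U := by
  rw [Pmax_sub_actionDensity]
  have hS := wilsonAction_nonneg' r U
  calc ∑ i : Fin 4, ∑ j : Fin 4, (if i < j then pDef r U (Torus.proj T x) i j else 0)
      ≤ ∑ _i : Fin 4, ∑ _j : Fin 4, wilsonAction r.ρ U := by
        refine Finset.sum_le_sum fun i _ => Finset.sum_le_sum fun j _ => ?_
        split_ifs with hij
        · exact pDef_le_wilsonAction r U _ hij
        · exact hS
    _ = 16 * wilsonAction r.ρ U := by simp [Finset.sum_const, Finset.card_univ]; ring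

omit [IsTopologicalGroup G] [CompactSpace G] [BorelSpace G] in
/-- The action density never exceeds its flat value. [folklore] -/
theorem actionDensity_lift_le_Pmax (T : ℕ) (U : GaugeConfig 4 T G) :
    actionDensity r.ρ (torusLift T U) ≤ Pmax r := by
  have h := Pmax_sub_actionDensity_nonneg r T U 0
  rw [neg_zero, configShift_zero'] at h
  linarith

end TorusRegularity

end

end Summit.QuantumFields.YangMills.Theorems.BalabanStepParabolic.Negative
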